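import Mathlib.Analysis.InnerProductSpace.Spectrum
import Mathlib.LinearAlgebra.Determinant
import Mathlib.Analysis.SpecialFunctions.Log.Basic
import HarnessLib

/-!
# Determinant of a coercive symmetric operator: `λ^m ≤ det A ≤ Λ^m`, `|log det A| ≤ m·max(|log λ|, |log Λ|)`
# (layer (B3) bookkeeping of the DIRECT Laplace road to ⟨stmt-QuantumFields-24204⟩: the constant `|log Σ_s c_s| ≤ poly(L)` of
# ✓`sharpTwistedLaplace_of_fixTubes`, where `c_s = ν(K)·w₀,s/√det A_s`)

Helper module (free-hands work of width seat ym-line-sfw-p2-w2 g49, cell ym-idea-1).  For a symmetric operator `A` on a finite-dimensional real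
inner product space with `λ‖y‖² ≤ ⟪Ay,y⟫ ≤ Λ‖y‖²`:
* `det_eq_prod_eigenvalues_of_isSymmetric` — `det A = ∏ eigenvalues` (Mathlib's orthonormal eigenvector basis);
* ★ `pow_le_det_of_coercive` ∕ `det_le_pow_of_bounded` — `λ^m ≤ det A ≤ Λ^m`, `m = finrank`;
* ★ `abs_log_det_le` — `|log det A| ≤ m · max(|log λ|, |log Λ|)` (`0 < λ`): with `m = 18L⁴` and `λ ≥ 1/poly(L)`, `Λ ≤ poly(L)` this is the
  `poly(L)` control of `log √det A_s` the window-data stub needs.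
Everything is PROVED; no definitions, no named facts.  HONEST FRAMING: linear algebra; ⟨24204⟩, ⟨24319⟩ and every rung stay OPEN; the Yang–Mills mass
gap (Clay) is NOT touched; no summit is proved by a line.
-/

noncomputable section

open Module
open scoped BigOperators InnerProductSpace

namespace Summit.QuantumFields.YangMills.Theorems.QuantitativeLaplace

variable {V : Type*} [NormedAddCommGroup V] [InnerProductSpace ℝ V] [FiniteDimensional ℝ V]

/-- `det A = ∏ᵢ λᵢ` over Mathlib's orthonormal eigenvector basis of a symmetric operator. [folklore] -/
theorem det_eq_prod_eigenvalues_of_isSymmetric {A : V →ₗ[ℝ] V} (hA : A.IsSymmetric) :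
    LinearMap.det A = ∏ i, hA.eigenvalues (rfl : finrank ℝ V = finrank ℝ V) i := by
  set b := hA.eigenvectorBasis (rfl : finrank ℝ V = finrank ℝ V) with hb
  have hev : ∀ i, A (b i) = hA.eigenvalues rfl i • b i := fun i => by
    have h := hA.apply_eigenvectorBasis (rfl : finrank ℝ V = finrank ℝ V) i
    rw [hb]
    exact h
  have hM : LinearMap.toMatrix b.toBasis b.toBasis A = Matrix.diagonal (hA.eigenvalues rfl) := by
    ext i j
    rw [LinearMap.toMatrix_apply, OrthonormalBasis.coe_toBasis, hev j, map_smul, Finsupp.smul_apply,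
      OrthonormalBasis.coe_toBasis_repr_apply, OrthonormalBasis.repr_self, PiLp.single_apply,
      Matrix.diagonal_apply, smul_eq_mul]
    split_ifs with h
    · rw [h, mul_one]
    · rw [mul_zero]
  rw [← LinearMap.det_toMatrix b.toBasis, hM, Matrix.det_diagonal]

/-- The eigenvalues of Mathlib's eigenvector basis are Rayleigh quotients: `λᵢ = ⟪A bᵢ, bᵢ⟫`. [folklore] -/
theorem eigenvalues_eq_inner {A : V →ₗ[ℝ] V} (hA : A.IsSymmetric) (i : Fin (finrank ℝ V)) :
    hA.eigenvalues (rfl : finrank ℝ V = finrank ℝ V) i =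
      ⟪A (hA.eigenvectorBasis rfl i), hA.eigenvectorBasis rfl i⟫_ℝ := by
  have hev : A (hA.eigenvectorBasis rfl i) = hA.eigenvalues rfl i • hA.eigenvectorBasis rfl i := by
    exact hA.apply_eigenvectorBasis (rfl : finrank ℝ V = finrank ℝ V) i
  have h1 : ‖hA.eigenvectorBasis (rfl : finrank ℝ V = finrank ℝ V) i‖ = 1 := (hA.eigenvectorBasis rfl).orthonormal.1 i
  rw [hev, real_inner_smul_left, real_inner_self_eq_norm_sq, h1, one_pow, mul_one]

/-- ★ **Lower determinant bound from coercivity**: `λ‖y‖² ≤ ⟪Ay,y⟫` (`0 ≤ λ`) gives `λ^m ≤ det A`. [folklore] -/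
theorem pow_le_det_of_coercive {A : V →ₗ[ℝ] V} (hA : A.IsSymmetric) {lam : ℝ} (hlam : 0 ≤ lam)
    (hlo : ∀ y : V, lam * ‖y‖ ^ 2 ≤ ⟪A y, y⟫_ℝ) : lam ^ finrank ℝ V ≤ LinearMap.det A := by
  rw [det_eq_prod_eigenvalues_of_isSymmetric hA]
  have h : ∀ i, lam ≤ hA.eigenvalues (rfl : finrank ℝ V = finrank ℝ V) i := fun i => by
    rw [eigenvalues_eq_inner hA i]
    have h1 : ‖hA.eigenvectorBasis (rfl : finrank ℝ V = finrank ℝ V) i‖ = 1 := (hA.eigenvectorBasis rfl).orthonormal.1 i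
    have := hlo (hA.eigenvectorBasis rfl i)
    rw [h1, one_pow, mul_one] at this
    exact this
  calc lam ^ finrank ℝ V = ∏ _i : Fin (finrank ℝ V), lam := by rw [Finset.prod_const, Finset.card_univ, Fintype.card_fin]
    _ ≤ ∏ i, hA.eigenvalues (rfl : finrank ℝ V = finrank ℝ V) i := Finset.prod_le_prod (fun i _ => hlam) fun i _ => h i

/-- ★ **Upper determinant bound**: `⟪Ay,y⟫ ≤ Λ‖y‖²` and `0 ≤ ⟪Ay,y⟫` give `det A ≤ Λ^m`. [folklore] -/
theorem det_le_pow_of_bounded {A : V →ₗ[ℝ] V} (hA : A.IsSymmetric) {Λ : ℝ} (hpos : ∀ y : V, 0 ≤ ⟪A y, y⟫_ℝ)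
    (hhi : ∀ y : V, ⟪A y, y⟫_ℝ ≤ Λ * ‖y‖ ^ 2) : LinearMap.det A ≤ Λ ^ finrank ℝ V := by
  rw [det_eq_prod_eigenvalues_of_isSymmetric hA]
  have h1 : ∀ i, ‖hA.eigenvectorBasis (rfl : finrank ℝ V = finrank ℝ V) i‖ = 1 := fun i => (hA.eigenvectorBasis rfl).orthonormal.1 i
  have h : ∀ i, hA.eigenvalues (rfl : finrank ℝ V = finrank ℝ V) i ≤ Λ := fun i => by
    rw [eigenvalues_eq_inner hA i]
    have := hhi (hA.eigenvectorBasis rfl i)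
    rw [h1, one_pow, mul_one] at this
    exact this
  have h0 : ∀ i, 0 ≤ hA.eigenvalues (rfl : finrank ℝ V = finrank ℝ V) i := fun i => by
    rw [eigenvalues_eq_inner hA i]; exact hpos _
  calc ∏ i, hA.eigenvalues (rfl : finrank ℝ V = finrank ℝ V) i ≤ ∏ _i : Fin (finrank ℝ V), Λ :=
        Finset.prod_le_prod (fun i _ => h0 i) fun i _ => h i
    _ = Λ ^ finrank ℝ V := by rw [Finset.prod_const, Finset.card_univ, Fintype.card_fin]

/-- ★ **`|log det A| ≤ m · max(|log λ|, |log Λ|)`** for `0 < λ`, `λ‖y‖² ≤ ⟪Ay,y⟫ ≤ Λ‖y‖²`. [folklore] -/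
theorem abs_log_det_le {A : V →ₗ[ℝ] V} (hA : A.IsSymmetric) {lam Λ : ℝ} (hlam : 0 < lam)
    (hlo : ∀ y : V, lam * ‖y‖ ^ 2 ≤ ⟪A y, y⟫_ℝ) (hhi : ∀ y : V, ⟪A y, y⟫_ℝ ≤ Λ * ‖y‖ ^ 2) :
    |Real.log (LinearMap.det A)| ≤ (finrank ℝ V : ℝ) * max |Real.log lam| |Real.log Λ| := by
  have hpos : ∀ y : V, 0 ≤ ⟪A y, y⟫_ℝ := fun y => (mul_nonneg hlam.le (sq_nonneg _)).trans (hlo y)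
  have hlow := pow_le_det_of_coercive hA hlam.le hlo
  have hup := det_le_pow_of_bounded hA hpos hhi
  have hdetpos : 0 < LinearMap.det A := lt_of_lt_of_le (pow_pos hlam _) hlow
  have e1 : Real.log (lam ^ finrank ℝ V) ≤ Real.log (LinearMap.det A) := Real.log_le_log (pow_pos hlam _) hlow
  have e2 : Real.log (LinearMap.det A) ≤ Real.log (Λ ^ finrank ℝ V) := Real.log_le_log hdetpos hup
  rw [Real.log_pow] at e1 e2
  have hm : (0 : ℝ) ≤ (finrank ℝ V : ℝ) := Nat.cast_nonneg _
  rw [abs_le]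
  constructor
  · have h1 : -(max |Real.log lam| |Real.log Λ|) ≤ Real.log lam := by
      have := neg_abs_le (Real.log lam); have := le_max_left |Real.log lam| |Real.log Λ|; linarith
    have h2 := mul_le_mul_of_nonneg_left h1 hm
    linarith
  · have h1 : Real.log Λ ≤ max |Real.log lam| |Real.log Λ| := (le_abs_self _).trans (le_max_right _ _)
    have h2 := mul_le_mul_of_nonneg_left h1 hm
    linarith

end Summit.QuantumFields.YangMills.Theorems.QuantitativeLaplace
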